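import Mathlib
import Summits.ResolutionOfSingularities.ResolutionOfSingularities.Theorems.WildQuotientsWildQuotientResolutionPthConeDefs
import Summits.ResolutionOfSingularities.ResolutionOfSingularities.Theorems.WildQuotientsWildQuotientResolutionConductorOneChartDefs

/-!
# The toric fan ideal `𝔞_{a,b}` of the cone `(1/p)(1^a, (−1)^b)`: definitions
(crux stmt-ResolutionOfSingularities-15640 `WildQuotients.WildQuotientResolution`, line `Sketch`;
chain w45c POST-V5 S2 = the conductor-𝟙 core `ConductorOneCore p n` of bricks; brick F6
`…ConductorOneToricFan` = the TORIC brick `T(a,b)` of res-L1-w45c-lead-1's `S2-DESIGN.md` §3 / §7 (7.6)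
(architecture of record, res-L1-w45c-plan-1 RULING 2026-08-27T17:07:17Z; HT binder shape RULING
16:55:33Z (5) / 17:31:45Z (2): `∃ J₀, J₀.radical = PthCone.irrelevant … ∧ Scheme.IsRegular (affineBlowup J₀)`).
[OURS · L1 W4.5c] — NOT a statement of any manuscript; replaces the role of no printed item.
Owner res-L1-w45c-stub-4 (gen 5).)

For `A : Finset (Fin n)` (the weight-`(+1)` variables; `Aᶜ` = the weight-`(−1)` variables; weight vector
`ConductorOne.chartWeight p n A`) the fan `Σ_{a,b}` of S2-DESIGN §3 refining the cone of
`(1/p)(1 on A, −1 off A)` has the interior rays `v_j = (j/p)·𝟙_A + ((p−j)/p)·𝟙_{Aᶜ}` (`0 < j < p`) and the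
maximal cones `⟨v_j, v_{j+1}, A∖ρ, Aᶜ∖ρ'⟩`; with the support function `ψ(v_j) = j(p−j)` (doubled, so that
EVERY prime `p`, including `p = 2`, and the Veronese case `Aᶜ = ∅` are covered by the same formulas) the
vertices of the Newton polyhedron are the monomials `x_ρ^{(p−j)(p−j−1)} x_{ρ'}^{j(j+1)}` (`0 ≤ j ≤ p−1`,
`ρ ∈ A`, `ρ' ∉ A`) and the ideal `𝔞 = PthCone.fanIdeal` is generated by the vertices and the
«vertex + dual basis vector» monomials (S2-DESIGN §3 «RING form»). This file only DEFINES the generator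
family (as monomials of the cone) and proves that the generators have weight `0`:
* `PthCone.EndIdx S T`, `PthCone.endExp` — generators attached to an end vertex `x_ρ^{p(p−1)}`
  (`ρ ∈ S`): the vertex, `x_ρ^{p²}`, `x_ρ^{p(p−1)−1} x_l` (`l ∈ S`), `x_ρ^{(p−1)²} x_{l'}` (`l' ∈ T`); used with
  `(S,T) = (A, Aᶜ)` AND `(S,T) = (Aᶜ, A)` (the two ends of the fan are exchanged by `A ↔ Aᶜ`);
* `PthCone.MidIdx`, `PthCone.vtxExp`, `PthCone.qExp`, `PthCone.midExp` — the middle vertices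
  `x_ρ^{(p−j)(p−j−1)} x_{ρ'}^{j(j+1)}` (`1 ≤ j ≤ p−2`), the edge mid-points `x_ρ^{(p−i)²} x_{ρ'}^{i²}`
  (`1 ≤ i ≤ p−1`) and the moved vertices `· x_l/x_ρ` (`l ∈ A`), `· x_{l'}/x_{ρ'}` (`l' ∉ A`);
* `PthCone.FIdx`, `PthCone.fanExp`, `PthCone.weight_fanExp`, `PthCone.fanGen`, `PthCone.fanFamily`
  (re-indexed by `Fin _`, the format of `chartRing` / `JordanThree.isRegular_affineBlowup_of_charts`),
  `PthCone.fanIdeal k n p A := Ideal.span (Set.range (fanFamily k n p A))`; named constructors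
  `FIdx.v0 … FIdx.eb` (their exponents by `rfl` and the exhaustion lemma are in `…PthConeFanExponents`).
No notation, no instances (plan-1 §6 (30)); `p` prime is carried as `[Fact p.Prime]`.
-/

set_option linter.dupNamespace false

noncomputable section

open MvPolynomial

namespace Summit.ResolutionOfSingularities.ResolutionOfSingularities.Theorems.WildQuotientResolution.PthCone

open ConductorOne

variable (n p : ℕ)

/-! ## Exponent vectors -/

/-- The vertex exponent `(p−j)(p−j−1)·𝐞_ρ + j(j+1)·𝐞_{ρ'}` (`0 ≤ j ≤ p−1`). [OURS · L1 W4.5c] -/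
def vtxExp (j : ℕ) (ρ ρ' : Fin n) : Fin n →₀ ℕ :=
  Finsupp.single ρ ((p - j) * (p - j - 1)) + Finsupp.single ρ' (j * (j + 1))

/-- The edge mid-point exponent `(p−i)²·𝐞_ρ + i²·𝐞_{ρ'}` (`0 ≤ i ≤ p`). [OURS · L1 W4.5c] -/
def qExp (i : ℕ) (ρ ρ' : Fin n) : Fin n →₀ ℕ :=
  Finsupp.single ρ ((p - i) ^ 2) + Finsupp.single ρ' (i ^ 2)

/-- **Index type of the end generators** attached to the end vertices `x_ρ^{p(p−1)}`, `ρ ∈ S`: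
vertex `ρ` | pure power `ρ` | moved vertex `(ρ, l)`, `l ∈ S` | `(ρ, l')`, `l' ∈ T`. [OURS · L1 W4.5c] -/
abbrev EndIdx (S T : Finset (Fin n)) : Type :=
  (S ⊕ S) ⊕ ((S × S) ⊕ (S × T))

/-- The exponents of the end generators: `p(p−1)𝐞_ρ`, `p²𝐞_ρ`, `(p(p−1)−1)𝐞_ρ + 𝐞_l`, `(p−1)²𝐞_ρ + 𝐞_{l'}`.
[OURS · L1 W4.5c] -/
def endExp (S T : Finset (Fin n)) : EndIdx n S T → (Fin n →₀ ℕ)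
  | Sum.inl (Sum.inl ρ) => Finsupp.single (ρ : Fin n) (p * (p - 1))
  | Sum.inl (Sum.inr ρ) => Finsupp.single (ρ : Fin n) (p ^ 2)
  | Sum.inr (Sum.inl q) => Finsupp.single (q.1 : Fin n) (p * (p - 1) - 1) + Finsupp.single (q.2 : Fin n) 1
  | Sum.inr (Sum.inr q) => Finsupp.single (q.1 : Fin n) ((p - 1) ^ 2) + Finsupp.single (q.2 : Fin n) 1

variable (A : Finset (Fin n))

/-- **Index type of the middle generators** (`ρ ∈ A`, `ρ' ∈ Aᶜ`): vertex `(j, ρ, ρ')` (`j+1 ∈ [1, p−2]`) |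
mid-point `(i, ρ, ρ')` (`i+1 ∈ [1, p−1]`) | moved vertices `(j, ρ, ρ', l)`, `l ∈ A` | `(j, ρ, ρ', l')`,
`l' ∈ Aᶜ`. [OURS · L1 W4.5c] -/
abbrev MidIdx : Type :=
  ((Fin (p - 2) × A × (Aᶜ : Finset (Fin n))) ⊕ (Fin (p - 1) × A × (Aᶜ : Finset (Fin n)))) ⊕
    ((Fin (p - 2) × A × (Aᶜ : Finset (Fin n)) × A) ⊕
      (Fin (p - 2) × A × (Aᶜ : Finset (Fin n)) × (Aᶜ : Finset (Fin n))))

/-- The exponents of the middle generators. [OURS · L1 W4.5c] -/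
def midExp : MidIdx n p A → (Fin n →₀ ℕ)
  | Sum.inl (Sum.inl q) => vtxExp n p ((q.1 : ℕ) + 1) q.2.1 q.2.2
  | Sum.inl (Sum.inr q) => qExp n p ((q.1 : ℕ) + 1) q.2.1 q.2.2
  | Sum.inr (Sum.inl q) =>
      Finsupp.single (q.2.1 : Fin n) ((p - ((q.1 : ℕ) + 1)) * (p - ((q.1 : ℕ) + 1) - 1) - 1) +
        Finsupp.single (q.2.2.1 : Fin n) (((q.1 : ℕ) + 1) * ((q.1 : ℕ) + 2)) +
          Finsupp.single (q.2.2.2 : Fin n) 1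
  | Sum.inr (Sum.inr q) =>
      Finsupp.single (q.2.1 : Fin n) ((p - ((q.1 : ℕ) + 1)) * (p - ((q.1 : ℕ) + 1) - 1)) +
        Finsupp.single (q.2.2.1 : Fin n) (((q.1 : ℕ) + 1) * ((q.1 : ℕ) + 2) - 1) +
          Finsupp.single (q.2.2.2 : Fin n) 1

/-- **Index type of the fan generators**: `A`-end | `Aᶜ`-end | middle. [OURS · L1 W4.5c] -/
abbrev FIdx : Type :=
  (EndIdx n A Aᶜ ⊕ EndIdx n Aᶜ A) ⊕ MidIdx n p A

/-- The exponents of the fan generators. [OURS · L1 W4.5c] -/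
def fanExp : FIdx n p A → (Fin n →₀ ℕ)
  | Sum.inl (Sum.inl κ) => endExp n p A Aᶜ κ
  | Sum.inl (Sum.inr κ) => endExp n p Aᶜ A κ
  | Sum.inr κ => midExp n p A κ

/-! ## Named constructors of the index type and their exponents -/

namespace FIdx

variable {n p A}

/-- `A`-end vertex `x_ρ^{p(p−1)}`. [OURS · L1 W4.5c] -/
def v0 (ρ : A) : FIdx n p A := Sum.inl (Sum.inl (Sum.inl (Sum.inl ρ)))
/-- `A`-end pure power `x_ρ^{p²}`. [OURS · L1 W4.5c] -/
def q0 (ρ : A) : FIdx n p A := Sum.inl (Sum.inl (Sum.inl (Sum.inr ρ)))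
/-- `A`-end moved vertex `x_ρ^{p(p−1)−1} x_l`, `l ∈ A`. [OURS · L1 W4.5c] -/
def e0 (ρ l : A) : FIdx n p A := Sum.inl (Sum.inl (Sum.inr (Sum.inl (ρ, l))))
/-- `A`-end generator `x_ρ^{(p−1)²} x_{l'}`, `l' ∉ A`. [OURS · L1 W4.5c] -/
def x0 (ρ : A) (l' : (Aᶜ : Finset (Fin n))) : FIdx n p A := Sum.inl (Sum.inl (Sum.inr (Sum.inr (ρ, l'))))
/-- `Aᶜ`-end vertex `x_{ρ'}^{p(p−1)}`. [OURS · L1 W4.5c] -/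
def vp (ρ' : (Aᶜ : Finset (Fin n))) : FIdx n p A := Sum.inl (Sum.inr (Sum.inl (Sum.inl ρ')))
/-- `Aᶜ`-end pure power `x_{ρ'}^{p²}`. [OURS · L1 W4.5c] -/
def qp (ρ' : (Aᶜ : Finset (Fin n))) : FIdx n p A := Sum.inl (Sum.inr (Sum.inl (Sum.inr ρ')))
/-- `Aᶜ`-end moved vertex `x_{ρ'}^{p(p−1)−1} x_{l'}`, `l' ∉ A`. [OURS · L1 W4.5c] -/
def ep (ρ' l' : (Aᶜ : Finset (Fin n))) : FIdx n p A := Sum.inl (Sum.inr (Sum.inr (Sum.inl (ρ', l'))))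
/-- `Aᶜ`-end generator `x_{ρ'}^{(p−1)²} x_l`, `l ∈ A`. [OURS · L1 W4.5c] -/
def xp (ρ' : (Aᶜ : Finset (Fin n))) (l : A) : FIdx n p A := Sum.inl (Sum.inr (Sum.inr (Sum.inr (ρ', l))))
/-- Middle vertex `x_ρ^{(p−j−1)(p−j−2)} x_{ρ'}^{(j+1)(j+2)}` (`j + 1 ∈ [1, p−2]`). [OURS · L1 W4.5c] -/
def vm (j : Fin (p - 2)) (ρ : A) (ρ' : (Aᶜ : Finset (Fin n))) : FIdx n p A :=
  Sum.inr (Sum.inl (Sum.inl (j, ρ, ρ')))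
/-- Edge mid-point `x_ρ^{(p−i−1)²} x_{ρ'}^{(i+1)²}` (`i + 1 ∈ [1, p−1]`). [OURS · L1 W4.5c] -/
def qm (i : Fin (p - 1)) (ρ : A) (ρ' : (Aᶜ : Finset (Fin n))) : FIdx n p A :=
  Sum.inr (Sum.inl (Sum.inr (i, ρ, ρ')))
/-- Middle vertex moved inside `A`: `· x_l / x_ρ`. [OURS · L1 W4.5c] -/
def ea (j : Fin (p - 2)) (ρ : A) (ρ' : (Aᶜ : Finset (Fin n))) (l : A) : FIdx n p A :=
  Sum.inr (Sum.inr (Sum.inl (j, ρ, ρ', l)))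
/-- Middle vertex moved inside `Aᶜ`: `· x_{l'} / x_{ρ'}`. [OURS · L1 W4.5c] -/
def eb (j : Fin (p - 2)) (ρ : A) (ρ' l' : (Aᶜ : Finset (Fin n))) : FIdx n p A :=
  Sum.inr (Sum.inr (Sum.inr (j, ρ, ρ', l')))

end FIdx

/-! ## Weights -/

/-- The weight of an exponent for `chartWeight p n A` is `Σ_{l ∈ A} d_l − Σ_{l ∉ A} d_l` in `ZMod p`.
[OURS · L1 W4.5c] -/
theorem weight_chartWeight (d : Fin n →₀ ℕ) :
    Finsupp.weight (chartWeight p n A) d =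
      ((∑ l ∈ A, d l : ℕ) : ZMod p) - ((∑ l ∈ Aᶜ, d l : ℕ) : ZMod p) := by
  classical
  rw [Finsupp.weight_apply, Finsupp.sum_fintype _ _ (fun i => by simp),
    ← Finset.sum_add_sum_compl A]
  have hA : ∀ l ∈ A, d l • chartWeight p n A l = (d l : ZMod p) := fun l hl => by
    rw [chartWeight, if_pos hl, nsmul_eq_mul, mul_one]
  have hB : ∀ l ∈ Aᶜ, d l • chartWeight p n A l = -(d l : ZMod p) := fun l hl => by
    rw [chartWeight, if_neg (Finset.mem_compl.mp hl), nsmul_eq_mul, mul_neg, mul_one]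
  rw [Finset.sum_congr rfl hA, Finset.sum_congr rfl hB, Nat.cast_sum, Nat.cast_sum,
    Finset.sum_neg_distrib, sub_eq_add_neg]

/-- Criterion for weight `0`: the two partial degree sums agree in `ZMod p`. [OURS · L1 W4.5c] -/
theorem weight_chartWeight_eq_zero {d : Fin n →₀ ℕ}
    (h : ((∑ l ∈ A, d l : ℕ) : ZMod p) = ((∑ l ∈ Aᶜ, d l : ℕ) : ZMod p)) :
    Finsupp.weight (chartWeight p n A) d = 0 := by
  rw [weight_chartWeight, h, sub_self]

/-- `Σ_{l ∈ S} (single ρ a) l = a` for `ρ ∈ S`. [folklore] -/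
theorem sum_single_apply_of_mem {S : Finset (Fin n)} {ρ : Fin n} (hρ : ρ ∈ S) (a : ℕ) :
    ∑ l ∈ S, Finsupp.single ρ a l = a := by
  classical
  rw [Finset.sum_eq_single ρ (fun l _ hl => by rw [Finsupp.single_apply, if_neg (Ne.symm hl)])
    (fun h => absurd hρ h), Finsupp.single_eq_same]

/-- `Σ_{l ∈ S} (single ρ a) l = 0` for `ρ ∉ S`. [folklore] -/
theorem sum_single_apply_of_not_mem {S : Finset (Fin n)} {ρ : Fin n} (hρ : ρ ∉ S) (a : ℕ) :
    ∑ l ∈ S, Finsupp.single ρ a l = 0 := by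
  classical
  refine Finset.sum_eq_zero fun l hl => ?_
  rw [Finsupp.single_apply, if_neg]
  rintro rfl
  exact hρ hl

/-- `p − x = −x` in `ZMod p`. [folklore] -/
theorem natCast_sub_self_left {x : ℕ} (hx : x ≤ p) : ((p - x : ℕ) : ZMod p) = -(x : ZMod p) := by
  rw [Nat.cast_sub hx, ZMod.natCast_self, zero_sub]

/-- `p(p−1) − 1 + 1 = p(p−1)` for `2 ≤ p`. [folklore] -/
theorem mul_pred_sub_one_add_one (hp : 2 ≤ p) : p * (p - 1) - 1 + 1 = p * (p - 1) :=
  Nat.sub_add_cancel (Nat.one_le_iff_ne_zero.mpr (Nat.mul_ne_zero (by omega) (by omega)))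

/-- `(p−j)(p−j−1) = j(j+1)` in `ZMod p` (`j + 1 ≤ p`). [OURS · L1 W4.5c] -/
theorem natCast_vtx_left (j : ℕ) (hj : j + 1 ≤ p) :
    (((p - j) * (p - j - 1) : ℕ) : ZMod p) = ((j * (j + 1) : ℕ) : ZMod p) := by
  rw [Nat.cast_mul, Nat.sub_sub, natCast_sub_self_left p (by omega), natCast_sub_self_left p hj]
  push_cast
  ring

/-- `(p−i)² = i²` in `ZMod p` (`i ≤ p`). [OURS · L1 W4.5c] -/
theorem natCast_q_left (i : ℕ) (hi : i ≤ p) :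
    (((p - i) ^ 2 : ℕ) : ZMod p) = ((i ^ 2 : ℕ) : ZMod p) := by
  rw [Nat.cast_pow, natCast_sub_self_left p hi]
  push_cast
  ring

section Weights

variable [hp : Fact p.Prime]

/-- The end generators have weight `0`, for `(S,T) = (A, Aᶜ)`. [OURS · L1 W4.5c] -/
theorem weight_endExp_left (κ : EndIdx n A Aᶜ) :
    Finsupp.weight (chartWeight p n A) (endExp n p A Aᶜ κ) = 0 := by
  classical
  have hp2 : 2 ≤ p := hp.out.two_le
  apply weight_chartWeight_eq_zero
  rcases κ with (ρ | ρ) | (⟨ρ, l⟩ | ⟨ρ, l'⟩)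
  · rw [endExp, sum_single_apply_of_mem n ρ.2,
      sum_single_apply_of_not_mem n (Finset.notMem_compl.mpr ρ.2), Nat.cast_mul, ZMod.natCast_self,
      zero_mul, Nat.cast_zero]
  · rw [endExp, sum_single_apply_of_mem n ρ.2,
      sum_single_apply_of_not_mem n (Finset.notMem_compl.mpr ρ.2), Nat.cast_pow, ZMod.natCast_self,
      zero_pow two_ne_zero, Nat.cast_zero]
  · simp only [endExp, Finsupp.coe_add, Pi.add_apply, Finset.sum_add_distrib,
      sum_single_apply_of_mem n ρ.2, sum_single_apply_of_mem n l.2,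
      sum_single_apply_of_not_mem n (Finset.notMem_compl.mpr ρ.2),
      sum_single_apply_of_not_mem n (Finset.notMem_compl.mpr l.2)]
    rw [mul_pred_sub_one_add_one p hp2, Nat.cast_mul, ZMod.natCast_self, zero_mul, add_zero,
      Nat.cast_zero]
  · simp only [endExp, Finsupp.coe_add, Pi.add_apply, Finset.sum_add_distrib,
      sum_single_apply_of_mem n ρ.2, sum_single_apply_of_mem n l'.2,
      sum_single_apply_of_not_mem n (Finset.notMem_compl.mpr ρ.2),
      sum_single_apply_of_not_mem n (show (l' : Fin n) ∉ A from Finset.mem_compl.mp l'.2)]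
    rw [add_zero, zero_add, natCast_q_left p 1 (by omega), one_pow]

/-- The end generators have weight `0`, for `(S,T) = (Aᶜ, A)`. [OURS · L1 W4.5c] -/
theorem weight_endExp_right (κ : EndIdx n Aᶜ A) :
    Finsupp.weight (chartWeight p n A) (endExp n p Aᶜ A κ) = 0 := by
  classical
  have hp2 : 2 ≤ p := hp.out.two_le
  apply weight_chartWeight_eq_zero
  rcases κ with (ρ | ρ) | (⟨ρ, l⟩ | ⟨ρ, l'⟩)
  · rw [endExp, sum_single_apply_of_mem n ρ.2,
      sum_single_apply_of_not_mem n (show (ρ : Fin n) ∉ A from Finset.mem_compl.mp ρ.2), Nat.cast_mul,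
      ZMod.natCast_self, zero_mul, Nat.cast_zero]
  · rw [endExp, sum_single_apply_of_mem n ρ.2,
      sum_single_apply_of_not_mem n (show (ρ : Fin n) ∉ A from Finset.mem_compl.mp ρ.2), Nat.cast_pow,
      ZMod.natCast_self, zero_pow two_ne_zero, Nat.cast_zero]
  · simp only [endExp, Finsupp.coe_add, Pi.add_apply, Finset.sum_add_distrib,
      sum_single_apply_of_mem n ρ.2, sum_single_apply_of_mem n l.2,
      sum_single_apply_of_not_mem n (show (ρ : Fin n) ∉ A from Finset.mem_compl.mp ρ.2),
      sum_single_apply_of_not_mem n (show (l : Fin n) ∉ A from Finset.mem_compl.mp l.2)]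
    rw [mul_pred_sub_one_add_one p hp2, Nat.cast_mul, ZMod.natCast_self, zero_mul, add_zero,
      Nat.cast_zero]
  · simp only [endExp, Finsupp.coe_add, Pi.add_apply, Finset.sum_add_distrib,
      sum_single_apply_of_mem n ρ.2, sum_single_apply_of_mem n l'.2,
      sum_single_apply_of_not_mem n (show (ρ : Fin n) ∉ A from Finset.mem_compl.mp ρ.2),
      sum_single_apply_of_not_mem n (Finset.notMem_compl.mpr l'.2)]
    rw [add_zero, zero_add, natCast_q_left p 1 (by omega), one_pow]

/-- The middle generators have weight `0`. [OURS · L1 W4.5c] -/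
theorem weight_midExp (κ : MidIdx n p A) :
    Finsupp.weight (chartWeight p n A) (midExp n p A κ) = 0 := by
  classical
  apply weight_chartWeight_eq_zero
  rcases κ with (⟨j, ρ, ρ'⟩ | ⟨i, ρ, ρ'⟩) | (⟨j, ρ, ρ', l⟩ | ⟨j, ρ, ρ', l'⟩)
  · have hj : (j : ℕ) + 3 ≤ p := by have := j.2; omega
    simp only [midExp, vtxExp, Finsupp.coe_add, Pi.add_apply, Finset.sum_add_distrib,
      sum_single_apply_of_mem n ρ.2, sum_single_apply_of_mem n ρ'.2,
      sum_single_apply_of_not_mem n (Finset.notMem_compl.mpr ρ.2),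
      sum_single_apply_of_not_mem n (show (ρ' : Fin n) ∉ A from Finset.mem_compl.mp ρ'.2),
      add_zero, zero_add]
    exact natCast_vtx_left p _ (by omega)
  · have hi : (i : ℕ) + 2 ≤ p := by have := i.2; omega
    simp only [midExp, qExp, Finsupp.coe_add, Pi.add_apply, Finset.sum_add_distrib,
      sum_single_apply_of_mem n ρ.2, sum_single_apply_of_mem n ρ'.2,
      sum_single_apply_of_not_mem n (Finset.notMem_compl.mpr ρ.2),
      sum_single_apply_of_not_mem n (show (ρ' : Fin n) ∉ A from Finset.mem_compl.mp ρ'.2),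
      add_zero, zero_add]
    exact natCast_q_left p _ (by omega)
  · have hj : (j : ℕ) + 3 ≤ p := by have := j.2; omega
    simp only [midExp, Finsupp.coe_add, Pi.add_apply, Finset.sum_add_distrib,
      sum_single_apply_of_mem n ρ.2, sum_single_apply_of_mem n ρ'.2, sum_single_apply_of_mem n l.2,
      sum_single_apply_of_not_mem n (Finset.notMem_compl.mpr ρ.2),
      sum_single_apply_of_not_mem n (Finset.notMem_compl.mpr l.2),
      sum_single_apply_of_not_mem n (show (ρ' : Fin n) ∉ A from Finset.mem_compl.mp ρ'.2),
      add_zero, zero_add]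
    have h1 : 1 ≤ (p - ((j : ℕ) + 1)) * (p - ((j : ℕ) + 1) - 1) :=
      Nat.one_le_iff_ne_zero.mpr (Nat.mul_ne_zero (by omega) (by omega))
    rw [Nat.sub_add_cancel h1]
    exact natCast_vtx_left p _ (by omega)
  · have hj : (j : ℕ) + 3 ≤ p := by have := j.2; omega
    simp only [midExp, Finsupp.coe_add, Pi.add_apply, Finset.sum_add_distrib,
      sum_single_apply_of_mem n ρ.2, sum_single_apply_of_mem n ρ'.2, sum_single_apply_of_mem n l'.2,
      sum_single_apply_of_not_mem n (Finset.notMem_compl.mpr ρ.2),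
      sum_single_apply_of_not_mem n (show (ρ' : Fin n) ∉ A from Finset.mem_compl.mp ρ'.2),
      sum_single_apply_of_not_mem n (show (l' : Fin n) ∉ A from Finset.mem_compl.mp l'.2),
      add_zero, zero_add]
    have h1 : 1 ≤ ((j : ℕ) + 1) * ((j : ℕ) + 2) :=
      Nat.one_le_iff_ne_zero.mpr (Nat.mul_ne_zero (by omega) (by omega))
    rw [Nat.sub_add_cancel h1]
    exact natCast_vtx_left p _ (by omega)

/-- **The fan generators have weight `0`** (lie in the cone). [OURS · L1 W4.5c] -/
theorem weight_fanExp (κ : FIdx n p A) :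
    Finsupp.weight (chartWeight p n A) (fanExp n p A κ) = 0 := by
  rcases κ with (κ | κ) | κ
  · exact weight_endExp_left n p A κ
  · exact weight_endExp_right n p A κ
  · exact weight_midExp n p A κ

end Weights

/-! ## The generator family and the fan ideal -/

variable (k : Type) [Field k]

/-- **The fan generators** `x^{fanExp κ}` as elements of the cone `(1/p)(1 on A, −1 off A)`.
[OURS · L1 W4.5c] -/
def fanGen [Fact p.Prime] (κ : FIdx n p A) : cone k n p (chartWeight p n A) :=
  ⟨monomial (fanExp n p A κ) 1, monomial_mem_cone k n p _ (weight_fanExp n p A κ) 1⟩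

/-- The value of a fan generator as a polynomial. [OURS · L1 W4.5c] -/
@[simp] theorem coe_fanGen [Fact p.Prime] (κ : FIdx n p A) :
    ((fanGen n p A k κ : cone k n p (chartWeight p n A)) : MvPolynomial (Fin n) k) =
      monomial (fanExp n p A κ) 1 :=
  rfl

/-- The fan generators re-indexed by `Fin _` (the format of `chartRing`). [OURS · L1 W4.5c] -/
def fanFamily [Fact p.Prime] :
    Fin (Fintype.card (FIdx n p A)) → cone k n p (chartWeight p n A) :=
  fanGen n p A k ∘ (Fintype.equivFin (FIdx n p A)).symm

/-- `fanFamily (equivFin κ) = fanGen κ`. [OURS · L1 W4.5c] -/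
theorem fanFamily_equivFin [Fact p.Prime] (κ : FIdx n p A) :
    fanFamily n p A k (Fintype.equivFin (FIdx n p A) κ) = fanGen n p A k κ := by
  simp [fanFamily]

/-- `fanFamily` and `fanGen` have the same range. [OURS · L1 W4.5c] -/
theorem range_fanFamily [Fact p.Prime] :
    Set.range (fanFamily n p A k) = Set.range (fanGen n p A k) :=
  EquivLike.range_comp _ _

/-- **The fan ideal** `𝔞_{a,b}` of the cone `(1/p)(1 on A, −1 off A)`: the ideal generated by the fan
generators (vertices and vertex-plus-dual-basis monomials of the fan `Σ_{a,b}`, S2-DESIGN §3).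
[OURS · L1 W4.5c] -/
def fanIdeal [Fact p.Prime] : Ideal (cone k n p (chartWeight p n A)) :=
  Ideal.span (Set.range (fanFamily n p A k))

/-- A fan generator lies in the fan ideal. [OURS · L1 W4.5c] -/
theorem fanGen_mem_fanIdeal [Fact p.Prime] (κ : FIdx n p A) : fanGen n p A k κ ∈ fanIdeal n p A k := by
  rw [fanIdeal, ← fanFamily_equivFin]
  exact Ideal.subset_span ⟨_, rfl⟩

end Summit.ResolutionOfSingularities.ResolutionOfSingularities.Theorems.WildQuotientResolution.PthCone

end
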